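import Mathlib
import Summits.Ventures.PercRepro2.RootEdgeThreeMark
import Summits.Ventures.PercRepro2.BHKAvoid
import Summits.Ventures.PercRepro2.VdBKahn
import Summits.Ventures.PercRepro2.OrderPreservation

/-!
# (3M) is the polarised BHK slack between the two `v`-classes of the cluster law —
the point-split BHK candidate (PS)
(blind cell PercRepro2, night-3 g23, 2026-08-28; `proofs/NIGHT3-CERT.md` §32)

For a source `s`, avoided sets `X, Y`, cluster functionals `F, G` and a WEIGHT `w` on configurations,
the weighted `(X, Y)`-BHK form is
`S_w(F, G) = E[FG·w·1_{s↮X∩Y}]·E[w·1_{s↮X∪Y}] − E[F·w·1_{s↮X}]·E[G·w·1_{s↮Y}]` (`bhkFormW`); at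
`w = 1` it is the form of p1's `bhk_induced` (van den Berg–Häggström–Kahn, Thm 1.3), nonnegative for
nonnegative monotone `F, G` (`bhkForm_one_nonneg`).  It is a quadratic form in `w`, and its
polarisation is `mixedFormW`: **`S_{w₁+w₂} = S_{w₁} + S_{w₂} + M(w₁, w₂)`** (`bhkFormW_add`).

The POINT SPLIT at a vertex `v` is `1 = 1_{v ∈ C_s} + 1_{v ∉ C_s}`.  The seat's reading of the
unmerged 5-mark inequality (3M) = `RootEdge.ThreeMark` (g21/g22): with `s = a₂`, `X = Y = {a₁}`,
`F = h = 1 − g` the deleted-cluster functional of `b ∈ C(a₁)` (so `E[h·1_Q] = P(Q, b ∉ C(a₁))`),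
`G = 1_{o ∈ ·}` and the split at `v`, the (3M)-slack is EXACTLY the polarised slack
`M(1_{v ∈ C_s}, 1_{v ∉ C_s})` (`threeMark_slack_eq_mixedForm`): the BHK slack of `(h, o)` on `Q`
is `S(v̄-class) + S(v-class) + Λ`, the `v̄`-class slack is BHK with the avoided set `{a₁, v}`, the
`v`-class slack is NOT signed (g22 §31.5 (a)), and (3M) says that the CROSS part is nonnegative by
itself.

**(PS), a CANDIDATE (NOT claimed proved)** — `PointSplitBHK`: `M(1_{v ∈ C_s}, 1_{v ∉ C_s}) ≥ 0`
for every product law, every `X, Y`, every point `v` and all nonnegative monotone `F, G`; and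
`PointSplitBHKOne`: `M(1_{v ∈ C_s}, 1) ≥ 0`.  Census (own code, exact rationals, random
multigraphs `n ≤ 7`, `m ≤ 11`, `F, G` unions of ≤ 2 «contains a set» events, `X, Y` arbitrary):
0 failures / 2,400 for (PS), 0 / 1,100 for the second form; the class slack `S(1_{v ∈ C_s})` IS
negative on 2 / 400.  The split by a general increasing event `𝒜 = {x₃ ∈ ·} ∪ {x₁, x₂ ∈ ·}` FAILS
(star `s–x₁, x₂, x₃` plus `t–x₂`, `b = x₂`, `o = x₁`: slack `−1/512` at `p₃ = 3/4`, `c = 1/2`) — the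
POINT nature of the split is essential (§32).  `threeMark_of_pointSplitBHK`: (PS) ⟹ (3M), hence
(with g22's `rootCross_of_threeMark`) RootCross and the `a₃`-inactive root-edge rows.
Own work; standard axioms.
-/

namespace Summit.Ventures.PercRepro2

open UnionCluster

namespace CovForm

namespace PointSplit

variable {V : Type*} {E : Type*} [Fintype E] [DecidableEq E]
  {R : Type*} [Field R] [LinearOrder R] [IsStrictOrderedRing R]

/-! ## The weighted `(X, Y)`-BHK form and its polarisation -/

/-- `E[F(C_s) · w · 1_{s ↮ X}]`. -/
noncomputable def wExpect (p : E → R) (ends : E → Sym2 V) (s : V) (X : Finset V) (F : Set V → R)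
    (w : Config E → R) : R :=
  expect p (fun ω => F (cluster ends ω s) * w ω * (avoidAll ends s X).indicator 1 ω)

/-- The weighted `(X, Y)`-BHK form
`S_w(F, G) = E[FG·w·1_{s↮X∩Y}]·E[w·1_{s↮X∪Y}] − E[F·w·1_{s↮X}]·E[G·w·1_{s↮Y}]`. -/
noncomputable def bhkFormW [DecidableEq V] (p : E → R) (ends : E → Sym2 V) (s : V) (X Y : Finset V)
    (F G : Set V → R) (w : Config E → R) : R :=
  wExpect p ends s (X ∩ Y) (fun W => F W * G W) w * wExpect p ends s (X ∪ Y) (fun _ => 1) w -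
    wExpect p ends s X F w * wExpect p ends s Y G w

/-- The polarised form `M(w₁, w₂)` of `S_w`:
`E[FG·w₁·1_{X∩Y}]·E[w₂·1_{X∪Y}] + E[FG·w₂·1_{X∩Y}]·E[w₁·1_{X∪Y}] − E[F·w₁·1_X]·E[G·w₂·1_Y] −
E[F·w₂·1_X]·E[G·w₁·1_Y]`. -/
noncomputable def mixedFormW [DecidableEq V] (p : E → R) (ends : E → Sym2 V) (s : V)
    (X Y : Finset V) (F G : Set V → R) (w₁ w₂ : Config E → R) : R :=
  wExpect p ends s (X ∩ Y) (fun W => F W * G W) w₁ * wExpect p ends s (X ∪ Y) (fun _ => 1) w₂ +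
    wExpect p ends s (X ∩ Y) (fun W => F W * G W) w₂ * wExpect p ends s (X ∪ Y) (fun _ => 1) w₁ -
    wExpect p ends s X F w₁ * wExpect p ends s Y G w₂ -
    wExpect p ends s X F w₂ * wExpect p ends s Y G w₁

omit [LinearOrder R] [IsStrictOrderedRing R] in
/-- `wExpect` is additive in the weight. -/
lemma wExpect_add (p : E → R) (ends : E → Sym2 V) (s : V) (X : Finset V) (F : Set V → R)
    (w₁ w₂ : Config E → R) :
    wExpect p ends s X F (w₁ + w₂) = wExpect p ends s X F w₁ + wExpect p ends s X F w₂ := by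
  unfold wExpect
  rw [← expect_add]
  refine congrArg _ (funext fun ω => ?_)
  simp only [Pi.add_apply]
  ring

omit [LinearOrder R] [IsStrictOrderedRing R] in
/-- **Polarisation**: `S_{w₁ + w₂} = S_{w₁} + S_{w₂} + M(w₁, w₂)`. -/
theorem bhkFormW_add [DecidableEq V] (p : E → R) (ends : E → Sym2 V) (s : V) (X Y : Finset V)
    (F G : Set V → R) (w₁ w₂ : Config E → R) :
    bhkFormW p ends s X Y F G (w₁ + w₂) =
      bhkFormW p ends s X Y F G w₁ + bhkFormW p ends s X Y F G w₂ +
        mixedFormW p ends s X Y F G w₁ w₂ := by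
  unfold bhkFormW mixedFormW
  rw [wExpect_add, wExpect_add, wExpect_add, wExpect_add]
  ring

omit [LinearOrder R] [IsStrictOrderedRing R] in
/-- `M` is symmetric. -/
lemma mixedFormW_comm [DecidableEq V] (p : E → R) (ends : E → Sym2 V) (s : V) (X Y : Finset V)
    (F G : Set V → R) (w₁ w₂ : Config E → R) :
    mixedFormW p ends s X Y F G w₁ w₂ = mixedFormW p ends s X Y F G w₂ w₁ := by
  unfold mixedFormW
  ring

omit [LinearOrder R] [IsStrictOrderedRing R] in
/-- `M(w, w) = 2 S_w`. -/
lemma mixedFormW_self [DecidableEq V] (p : E → R) (ends : E → Sym2 V) (s : V) (X Y : Finset V)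
    (F G : Set V → R) (w : Config E → R) :
    mixedFormW p ends s X Y F G w w = 2 * bhkFormW p ends s X Y F G w := by
  unfold mixedFormW bhkFormW
  ring

/-! ## The form at weight `1` is BHK -/

/-- **BHK** (p1's `bhk_induced` on the whole graph): `S_1(F, G) ≥ 0` for nonnegative monotone
`F, G` and every `X, Y`. -/
theorem bhkForm_one_nonneg [Fintype V] [DecidableEq V] (p : E → R) (hp : IsProbVec p)
    (ends : E → Sym2 V) (s : V) (X Y : Finset V) {F G : Set V → R} (hF : Monotone F)
    (hG : Monotone G) (hF0 : ∀ S, 0 ≤ F S) (hG0 : ∀ S, 0 ≤ G S) :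
    0 ≤ bhkFormW p ends s X Y F G (fun _ => 1) := by
  have key := bhk_induced p hp ends s hF hG hF0 hG0 Finset.univ X Y (Finset.subset_univ _)
    (Finset.subset_univ _)
  simp only [REvent_univ] at key
  have e : ∀ (Z : Finset V) (H : Set V → R),
      clusterObs ends Finset.univ s H * (avoidAll ends s Z).indicator 1 =
        fun ω => H (cluster ends ω s) * (fun _ : Config E => (1 : R)) ω *
          (avoidAll ends s Z).indicator 1 ω := by
    intro Z H
    funext ω
    simp only [Pi.mul_apply, clusterObs_apply, clusterIn_univ, mul_one]
  have e1 : expect p (clusterObs ends Finset.univ s (F * G) *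
      (avoidAll ends s (X ∩ Y)).indicator 1) =
      wExpect p ends s (X ∩ Y) (fun W => F W * G W) (fun _ => 1) := by
    rw [e]; rfl
  have e2 : prob p (avoidAll ends s (X ∪ Y)) =
      wExpect p ends s (X ∪ Y) (fun _ => 1) (fun _ => 1) := by
    rw [prob_eq_expect_indicator]
    unfold wExpect
    refine congrArg _ (funext fun ω => ?_)
    simp only [one_mul]
  have e3 : expect p (clusterObs ends Finset.univ s F * (avoidAll ends s X).indicator 1) =
      wExpect p ends s X F (fun _ => 1) := by
    rw [e]; rfl
  have e4 : expect p (clusterObs ends Finset.univ s G * (avoidAll ends s Y).indicator 1) =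
      wExpect p ends s Y G (fun _ => 1) := by
    rw [e]; rfl
  rw [e1, e2, e3, e4] at key
  unfold bhkFormW
  linarith [key]

/-! ## The point split and the candidate (PS) -/

omit [Fintype E] [DecidableEq E] [LinearOrder R] [IsStrictOrderedRing R] in
/-- The point weights `1_{v ∈ C_s}` and `1_{v ∉ C_s}` sum to `1`. -/
lemma indicator_conn_add_compl (ends : E → Sym2 V) (s v : V) :
    (connEvent ends s v).indicator (1 : Config E → R) +
        ((connEvent ends s v)ᶜ).indicator (1 : Config E → R) = fun _ => 1 := by
  funext ω
  simp only [Pi.add_apply]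
  by_cases h : ω ∈ connEvent ends s v
  · rw [Set.indicator_of_mem h,
      Set.indicator_of_notMem (show ω ∉ (connEvent ends s v)ᶜ from fun h' => h' h)]
    simp
  · rw [Set.indicator_of_notMem h, Set.indicator_of_mem (show ω ∈ (connEvent ends s v)ᶜ from h)]
    simp

omit [LinearOrder R] [IsStrictOrderedRing R] in
/-- **The point split of the BHK slack**:
`S_1 = S_{1_{v ∈ C_s}} + S_{1_{v ∉ C_s}} + M(1_{v ∈ C_s}, 1_{v ∉ C_s})`. -/
theorem bhkForm_one_point_split [DecidableEq V] (p : E → R) (ends : E → Sym2 V) (s v : V)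
    (X Y : Finset V) (F G : Set V → R) :
    bhkFormW p ends s X Y F G (fun _ => 1) =
      bhkFormW p ends s X Y F G ((connEvent ends s v).indicator 1) +
        bhkFormW p ends s X Y F G (((connEvent ends s v)ᶜ).indicator 1) +
        mixedFormW p ends s X Y F G ((connEvent ends s v).indicator 1)
          (((connEvent ends s v)ᶜ).indicator 1) := by
  rw [← indicator_conn_add_compl (R := R) ends s v, bhkFormW_add]

/-- **(PS), a CANDIDATE (NOT claimed proved)** — point-split BHK: for every product law, every pair of
avoided sets `X, Y`, every vertex `v` and all nonnegative monotone cluster functionals `F, G`, the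
polarised BHK slack between the `v ∈ C_s` and the `v ∉ C_s` parts of the cluster law is
nonnegative: `E[FG·1_{vH}·1_{X∩Y}]·P(v̄H, X∪Y) + E[FG·1_{v̄H}·1_{X∩Y}]·P(vH, X∪Y) ≥
E[F·1_{vH}·1_X]·E[G·1_{v̄H}·1_Y] + E[F·1_{v̄H}·1_X]·E[G·1_{vH}·1_Y]`.  Census: 0 / 2,400 random
instances (night-3 g23, exact); FALSE for a general increasing split in place of `{v ∈ C_s}`. -/
def PointSplitBHK [DecidableEq V] (ends : E → Sym2 V) (s : V) : Prop :=
  ∀ (p : E → R), IsProbVec p → ∀ (X Y : Finset V) (v : V) (F G : Set V → R),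
    Monotone F → Monotone G → (∀ S, 0 ≤ F S) → (∀ S, 0 ≤ G S) →
      0 ≤ mixedFormW p ends s X Y F G ((connEvent ends s v).indicator 1)
        (((connEvent ends s v)ᶜ).indicator 1)

/-- **The second point-split form, a CANDIDATE (NOT claimed proved)**: `M(1_{v ∈ C_s}, 1) ≥ 0`,
i.e. `E[FG·1_{vH}·1_{X∩Y}]·P(X∪Y) + E[FG·1_{X∩Y}]·P(vH, X∪Y) ≥ E[F·1_{vH}·1_X]·E[G·1_Y] +
E[F·1_X]·E[G·1_{vH}·1_Y]` (`= M(1_{vH}, 1_{v̄H}) + 2·S_{1_{vH}}`).  Together with (PS) it says that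
the BHK slack is nonincreasing in the weight of every edge joining `v` to a vertex of `X ∩ Y`
(§32).  Census: 0 / 1,100 (night-3 g23, exact). -/
def PointSplitBHKOne [DecidableEq V] (ends : E → Sym2 V) (s : V) : Prop :=
  ∀ (p : E → R), IsProbVec p → ∀ (X Y : Finset V) (v : V) (F G : Set V → R),
    Monotone F → Monotone G → (∀ S, 0 ≤ F S) → (∀ S, 0 ≤ G S) →
      0 ≤ mixedFormW p ends s X Y F G ((connEvent ends s v).indicator 1) (fun _ => 1)

omit [LinearOrder R] [IsStrictOrderedRing R] in
/-- `M(1_{vH}, 1) = M(1_{vH}, 1_{v̄H}) + 2·S_{1_{vH}}`. -/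
lemma mixedForm_one_eq [DecidableEq V] (p : E → R) (ends : E → Sym2 V) (s v : V)
    (X Y : Finset V) (F G : Set V → R) :
    mixedFormW p ends s X Y F G ((connEvent ends s v).indicator 1) (fun _ => 1) =
      mixedFormW p ends s X Y F G ((connEvent ends s v).indicator 1)
          (((connEvent ends s v)ᶜ).indicator 1) +
        2 * bhkFormW p ends s X Y F G ((connEvent ends s v).indicator 1) := by
  rw [← indicator_conn_add_compl (R := R) ends s v]
  unfold mixedFormW bhkFormW
  rw [wExpect_add, wExpect_add, wExpect_add, wExpect_add]
  ring

end PointSplit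

end CovForm

end Summit.Ventures.PercRepro2
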